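import Mathlib
import HarnessLib
import Summits.ValiantsHypothesis.ValiantsHypothesis.Theorems.MonotoneRestorationOrbitRestorationQPInjectivePlacementsPoly
import Summits.ValiantsHypothesis.ValiantsHypothesis.Theorems.MonotoneRestorationOrbitRestorationQPCorePatternsAffine

/-!
# Core patterns, polynomial version WITH THE TOTAL SUM `U`: engine and injective placements

Route MonotoneRestoration, crux `OrbitRestorationQP` (stmt-ValiantsHypothesis-18293), SPAN-currency lane of the open
sub-rung A_∞ (`stub_sigmaPiSigmaValue`).  Helper (`--supports`), def-free.  The factors of a matrix-symmetric affine
product are local AFFINE forms `β₀ + δ·U + (cells, row pendants, column pendants)` (`LocalFormShape`), so the blocks of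
the twisted residue are polynomials in the local atoms AND the invariant total sum `U = Σ_{ij} x_{ij}`.  This file adds
`U` (and the constants) to the atom set of `…CorePatternsPoly.lean` / `…InjectivePlacementsPoly.lean`: polynomials
`P ∈ MvPolynomial (((Fin r × Fin c) ⊕ (Fin r ⊕ Fin c)) ⊕ Unit) ℂ`, the `Unit` atom valued `U` at every placement.

* `exists_lists_of_wordU` — kind separation of a word in the atoms `x_{ab}`, `R_a`, `C_b`, `U`: a power of `U` times a
  core-pattern triple product, uniformly in the placement;
* **`sum_placements_aevalU_mem_narrowSpan`** — ENGINE with `U`: all-placements sums of `P(x_{φa,ψb}, R_{φa}, C_{ψb}, U)`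
  lie in `span_ℂ {hom_{F,n} : tw F ≤ r + c + 1}` (the span is closed under multiplication by powers of `U`,
  `NarrowSpanAlgebra.narrowSpan_mul_mem`, `CorePatterns.invariantPart_pow_mem_narrowSpan`);
* `aevalU_atoms_comp_rows`, `aevalU_atoms_comp_cols`, `rename_rowCol_aevalU_atoms` — merging and moving placements;
* **`sum_injective_injective_aevalU_mem_narrowSpan`** — INJ with `U`: the sum over injective row and column placements
  lies in `span_ℂ {hom_{F,n} : tw F ≤ r + c + 1}` (generic merge lemmas `sum_injective_mem_of_merge`).

No registered stub is closed; the crux and VP ≠ VNP are not moved. [folklore]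
-/

noncomputable section

-- `Summit.ValiantsHypothesis.ValiantsHypothesis.…` is the tree's single-conjunct layout (Sub = Summit).
set_option linter.dupNamespace false

namespace Summit.ValiantsHypothesis.ValiantsHypothesis.Theorems

namespace CorePatterns

open MvPolynomial Finset Equiv
open Literature.Computability.AlgebraicComplexity (homPoly)
open Literature.Combinatorics.SimpleGraph (treewidth)

/-! ### Kind separation with `U` -/

/-- **Kind separation with the total sum.**  A word in the atoms `x_{ab}`, `R_a`, `C_b`, `U` evaluates, at every
placement and uniformly, to a power of `U` times a core-pattern triple product. [folklore] -/
theorem exists_lists_of_wordU (r c : ℕ) :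
    ∀ (k : ℕ) (w : Fin k → ((Fin r × Fin c) ⊕ (Fin r ⊕ Fin c)) ⊕ Unit),
      ∃ (m₁ : ℕ) (cells : Fin m₁ → Fin r × Fin c) (m₂ : ℕ) (rp : Fin m₂ → Fin r) (m₃ : ℕ) (cp : Fin m₃ → Fin c) (e : ℕ),
        ∀ (n : ℕ) (φ : Fin r → Fin n) (ψ : Fin c → Fin n),
          (∏ i : Fin k, (Sum.elim (Sum.elim (fun ab : Fin r × Fin c => (X (φ ab.1, ψ ab.2) : MvPolynomial (Fin n × Fin n) ℂ))
              (Sum.elim (fun a : Fin r => ∑ j : Fin n, (X (φ a, j) : MvPolynomial (Fin n × Fin n) ℂ))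
                (fun b : Fin c => ∑ j : Fin n, (X (j, ψ b) : MvPolynomial (Fin n × Fin n) ℂ))))
              (fun _ : Unit => ∑ i : Fin n, ∑ j : Fin n, (X (i, j) : MvPolynomial (Fin n × Fin n) ℂ)) (w i)) : _) =
          (∑ i : Fin n, ∑ j : Fin n, (X (i, j) : MvPolynomial (Fin n × Fin n) ℂ)) ^ e *
          ((∏ i : Fin m₁, (X (φ (cells i).1, ψ (cells i).2) : MvPolynomial (Fin n × Fin n) ℂ)) *
            (∏ i : Fin m₂, ∑ j : Fin n, (X (φ (rp i), j) : MvPolynomial (Fin n × Fin n) ℂ)) *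
            (∏ i : Fin m₃, ∑ j : Fin n, (X (j, ψ (cp i)) : MvPolynomial (Fin n × Fin n) ℂ))) := by
  intro k
  induction k with
  | zero =>
    intro w
    exact ⟨0, Fin.elim0, 0, Fin.elim0, 0, Fin.elim0, 0, fun n φ ψ => by simp⟩
  | succ k ih =>
    intro w
    obtain ⟨m₁, cells, m₂, rp, m₃, cp, e, h⟩ := ih (Fin.tail w)
    have htail : ∀ (n : ℕ) (φ : Fin r → Fin n) (ψ : Fin c → Fin n),
        (∏ i : Fin k, (Sum.elim (Sum.elim (fun ab : Fin r × Fin c => (X (φ ab.1, ψ ab.2) : MvPolynomial (Fin n × Fin n) ℂ))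
            (Sum.elim (fun a : Fin r => ∑ j : Fin n, (X (φ a, j) : MvPolynomial (Fin n × Fin n) ℂ))
              (fun b : Fin c => ∑ j : Fin n, (X (j, ψ b) : MvPolynomial (Fin n × Fin n) ℂ))))
            (fun _ : Unit => ∑ i : Fin n, ∑ j : Fin n, (X (i, j) : MvPolynomial (Fin n × Fin n) ℂ)) (w i.succ)) : _) =
        (∑ i : Fin n, ∑ j : Fin n, (X (i, j) : MvPolynomial (Fin n × Fin n) ℂ)) ^ e *
          ((∏ i : Fin m₁, (X (φ (cells i).1, ψ (cells i).2) : MvPolynomial (Fin n × Fin n) ℂ)) *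
            (∏ i : Fin m₂, ∑ j : Fin n, (X (φ (rp i), j) : MvPolynomial (Fin n × Fin n) ℂ)) *
            (∏ i : Fin m₃, ∑ j : Fin n, (X (j, ψ (cp i)) : MvPolynomial (Fin n × Fin n) ℂ))) :=
      fun n φ ψ => h n φ ψ
    rcases hw : w 0 with (⟨a, b⟩ | (a | b)) | u
    · refine ⟨m₁ + 1, Fin.cons (a, b) cells, m₂, rp, m₃, cp, e, fun n φ ψ => ?_⟩
      rw [Fin.prod_univ_succ, hw, htail n φ ψ, Fin.prod_univ_succ (n := m₁)]
      simp only [Sum.elim_inl, Fin.cons_zero, Fin.cons_succ]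
      ring
    · refine ⟨m₁, cells, m₂ + 1, Fin.cons a rp, m₃, cp, e, fun n φ ψ => ?_⟩
      rw [Fin.prod_univ_succ, hw, htail n φ ψ, Fin.prod_univ_succ (n := m₂)]
      simp only [Sum.elim_inr, Sum.elim_inl, Fin.cons_zero, Fin.cons_succ]
      ring
    · refine ⟨m₁, cells, m₂, rp, m₃ + 1, Fin.cons b cp, e, fun n φ ψ => ?_⟩
      rw [Fin.prod_univ_succ, hw, htail n φ ψ, Fin.prod_univ_succ (n := m₃)]
      simp only [Sum.elim_inl, Sum.elim_inr, Fin.cons_zero, Fin.cons_succ]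
      ring
    · refine ⟨m₁, cells, m₂, rp, m₃, cp, e + 1, fun n φ ψ => ?_⟩
      rw [Fin.prod_univ_succ, hw, htail n φ ψ]
      simp only [Sum.elim_inr]
      ring

/-! ### The engine with `U` -/

/-- **All-placements sums of a polynomial in the local atoms and `U` are narrow, treewidth `≤ r + c + 1`.**
[folklore; cite: DwivediPagoSeppelt2026, §8] -/
theorem sum_placements_aevalU_mem_narrowSpan (n r c : ℕ)
    (P : MvPolynomial (((Fin r × Fin c) ⊕ (Fin r ⊕ Fin c)) ⊕ Unit) ℂ) :
    (∑ φ : Fin r → Fin n, ∑ ψ : Fin c → Fin n,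
      aeval (Sum.elim (Sum.elim (fun ab : Fin r × Fin c => (X (φ ab.1, ψ ab.2) : MvPolynomial (Fin n × Fin n) ℂ))
          (Sum.elim (fun a : Fin r => ∑ j : Fin n, (X (φ a, j) : MvPolynomial (Fin n × Fin n) ℂ))
            (fun b : Fin c => ∑ j : Fin n, (X (j, ψ b) : MvPolynomial (Fin n × Fin n) ℂ))))
          (fun _ : Unit => ∑ i : Fin n, ∑ j : Fin n, (X (i, j) : MvPolynomial (Fin n × Fin n) ℂ))) P) ∈
    Submodule.span ℂ {p : MvPolynomial (Fin n × Fin n) ℂ |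
        ∃ (a b : ℕ) (E : Multiset (Fin a × Fin b)),
          treewidth (SimpleGraph.fromRel fun u v : Fin a ⊕ Fin b =>
            ∃ e ∈ E, u = Sum.inl e.1 ∧ v = Sum.inr e.2) ≤ r + c + 1 ∧ p = homPoly E n ℂ} := by
  classical
  have hP : ∀ (φ : Fin r → Fin n) (ψ : Fin c → Fin n),
      aeval (Sum.elim (Sum.elim (fun ab : Fin r × Fin c => (X (φ ab.1, ψ ab.2) : MvPolynomial (Fin n × Fin n) ℂ))
          (Sum.elim (fun a : Fin r => ∑ j : Fin n, (X (φ a, j) : MvPolynomial (Fin n × Fin n) ℂ))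
            (fun b : Fin c => ∑ j : Fin n, (X (j, ψ b) : MvPolynomial (Fin n × Fin n) ℂ))))
          (fun _ : Unit => ∑ i : Fin n, ∑ j : Fin n, (X (i, j) : MvPolynomial (Fin n × Fin n) ℂ))) P =
      ∑ s ∈ P.support, C (coeff s P) *
        s.prod (fun t k => (Sum.elim (Sum.elim (fun ab : Fin r × Fin c => (X (φ ab.1, ψ ab.2) : MvPolynomial (Fin n × Fin n) ℂ))
          (Sum.elim (fun a : Fin r => ∑ j : Fin n, (X (φ a, j) : MvPolynomial (Fin n × Fin n) ℂ))
            (fun b : Fin c => ∑ j : Fin n, (X (j, ψ b) : MvPolynomial (Fin n × Fin n) ℂ))))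
          (fun _ : Unit => ∑ i : Fin n, ∑ j : Fin n, (X (i, j) : MvPolynomial (Fin n × Fin n) ℂ)) t) ^ k) := by
    intro φ ψ
    conv_lhs => rw [P.as_sum]
    rw [map_sum]
    refine Finset.sum_congr rfl fun s _ => ?_
    rw [aeval_monomial, algebraMap_eq]
  simp_rw [hP]
  rw [sum_sum_sum_comm]
  refine Submodule.sum_mem _ fun s _ => ?_
  obtain ⟨K, w, hw⟩ := exists_word_of_finsupp s
  obtain ⟨m₁, cells, m₂, rp, m₃, cp, e, h⟩ := exists_lists_of_wordU r c K w
  have hterm : ∀ (φ : Fin r → Fin n) (ψ : Fin c → Fin n),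
      C (coeff s P) *
        s.prod (fun t k => (Sum.elim (Sum.elim (fun ab : Fin r × Fin c => (X (φ ab.1, ψ ab.2) : MvPolynomial (Fin n × Fin n) ℂ))
          (Sum.elim (fun a : Fin r => ∑ j : Fin n, (X (φ a, j) : MvPolynomial (Fin n × Fin n) ℂ))
            (fun b : Fin c => ∑ j : Fin n, (X (j, ψ b) : MvPolynomial (Fin n × Fin n) ℂ))))
          (fun _ : Unit => ∑ i : Fin n, ∑ j : Fin n, (X (i, j) : MvPolynomial (Fin n × Fin n) ℂ)) t) ^ k) =
      (C (coeff s P) * (∑ i : Fin n, ∑ j : Fin n, (X (i, j) : MvPolynomial (Fin n × Fin n) ℂ)) ^ e) *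
        ((∏ i : Fin m₁, (X (φ (cells i).1, ψ (cells i).2) : MvPolynomial (Fin n × Fin n) ℂ)) *
          (∏ i : Fin m₂, ∑ j : Fin n, (X (φ (rp i), j) : MvPolynomial (Fin n × Fin n) ℂ)) *
          (∏ i : Fin m₃, ∑ j : Fin n, (X (j, ψ (cp i)) : MvPolynomial (Fin n × Fin n) ℂ))) := by
    intro φ ψ
    rw [hw (MvPolynomial (Fin n × Fin n) ℂ), h n φ ψ]
    ring
  simp_rw [hterm]
  simp_rw [← Finset.mul_sum]
  refine NarrowSpanAlgebra.narrowSpan_mul_mem n (r + c + 1) ?_ ?_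
  · rw [← smul_eq_C_mul]
    refine Submodule.smul_mem _ _ ?_
    have hU := invariantPart_pow_mem_narrowSpan n (r + c + 1) (by omega) 0 1 e
    simpa using hU
  · refine (Submodule.span_mono ?_) (corePattern_mem_narrowSpan n r c m₁ m₂ m₃ cells rp cp)
    rintro p ⟨a, b, E, hE, rfl⟩
    exact ⟨a, b, E, hE.trans (by omega), rfl⟩

/-! ### Placing a polynomial in the atoms and `U` -/

/-- **Placing along `g ∘ π` (rows) = placing the row-merged polynomial along `g`** (with `U`). [folklore] -/
theorem aevalU_atoms_comp_rows (n r r' c : ℕ) (P : MvPolynomial (((Fin r × Fin c) ⊕ (Fin r ⊕ Fin c)) ⊕ Unit) ℂ)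
    (π : Fin r → Fin r') (g : Fin r' → Fin n) (ψ : Fin c → Fin n) :
    aeval (Sum.elim (Sum.elim (fun ab : Fin r × Fin c => (X ((g ∘ π) ab.1, ψ ab.2) : MvPolynomial (Fin n × Fin n) ℂ))
        (Sum.elim (fun a : Fin r => ∑ j : Fin n, (X ((g ∘ π) a, j) : MvPolynomial (Fin n × Fin n) ℂ))
          (fun b : Fin c => ∑ j : Fin n, (X (j, ψ b) : MvPolynomial (Fin n × Fin n) ℂ))))
        (fun _ : Unit => ∑ i : Fin n, ∑ j : Fin n, (X (i, j) : MvPolynomial (Fin n × Fin n) ℂ))) P =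
      aeval (Sum.elim (Sum.elim (fun ab : Fin r' × Fin c => (X (g ab.1, ψ ab.2) : MvPolynomial (Fin n × Fin n) ℂ))
        (Sum.elim (fun a : Fin r' => ∑ j : Fin n, (X (g a, j) : MvPolynomial (Fin n × Fin n) ℂ))
          (fun b : Fin c => ∑ j : Fin n, (X (j, ψ b) : MvPolynomial (Fin n × Fin n) ℂ))))
        (fun _ : Unit => ∑ i : Fin n, ∑ j : Fin n, (X (i, j) : MvPolynomial (Fin n × Fin n) ℂ)))
        (rename (Sum.map (Sum.map (Prod.map π id) (Sum.map π id)) id) P) := by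
  rw [aeval_rename]
  congr 1
  refine MvPolynomial.algHom_ext fun t => ?_
  rw [aeval_X, aeval_X]
  rcases t with (⟨a, b⟩ | (a | b)) | u <;> rfl

/-- **Placing along `g ∘ π` (columns) = placing the column-merged polynomial along `g`** (with `U`). [folklore] -/
theorem aevalU_atoms_comp_cols (n r c c' : ℕ) (P : MvPolynomial (((Fin r × Fin c) ⊕ (Fin r ⊕ Fin c)) ⊕ Unit) ℂ)
    (π : Fin c → Fin c') (φ : Fin r → Fin n) (g : Fin c' → Fin n) :
    aeval (Sum.elim (Sum.elim (fun ab : Fin r × Fin c => (X (φ ab.1, (g ∘ π) ab.2) : MvPolynomial (Fin n × Fin n) ℂ))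
        (Sum.elim (fun a : Fin r => ∑ j : Fin n, (X (φ a, j) : MvPolynomial (Fin n × Fin n) ℂ))
          (fun b : Fin c => ∑ j : Fin n, (X (j, (g ∘ π) b) : MvPolynomial (Fin n × Fin n) ℂ))))
        (fun _ : Unit => ∑ i : Fin n, ∑ j : Fin n, (X (i, j) : MvPolynomial (Fin n × Fin n) ℂ))) P =
      aeval (Sum.elim (Sum.elim (fun ab : Fin r × Fin c' => (X (φ ab.1, g ab.2) : MvPolynomial (Fin n × Fin n) ℂ))
        (Sum.elim (fun a : Fin r => ∑ j : Fin n, (X (φ a, j) : MvPolynomial (Fin n × Fin n) ℂ))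
          (fun b : Fin c' => ∑ j : Fin n, (X (j, g b) : MvPolynomial (Fin n × Fin n) ℂ))))
        (fun _ : Unit => ∑ i : Fin n, ∑ j : Fin n, (X (i, j) : MvPolynomial (Fin n × Fin n) ℂ)))
        (rename (Sum.map (Sum.map (Prod.map id π) (Sum.map id π)) id) P) := by
  rw [aeval_rename]
  congr 1
  refine MvPolynomial.algHom_ext fun t => ?_
  rw [aeval_X, aeval_X]
  rcases t with (⟨a, b⟩ | (a | b)) | u <;> rfl

/-- **A row/column renaming moves the placement of a polynomial in the atoms and `U`.** [folklore] -/
theorem rename_rowCol_aevalU_atoms (n r c : ℕ) (P : MvPolynomial (((Fin r × Fin c) ⊕ (Fin r ⊕ Fin c)) ⊕ Unit) ℂ)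
    (φ : Fin r → Fin n) (ψ : Fin c → Fin n) (σ τ : Perm (Fin n)) :
    rename (fun Q : Fin n × Fin n => (σ Q.1, τ Q.2))
      (aeval (Sum.elim (Sum.elim (fun ab : Fin r × Fin c => (X (φ ab.1, ψ ab.2) : MvPolynomial (Fin n × Fin n) ℂ))
        (Sum.elim (fun a : Fin r => ∑ j : Fin n, (X (φ a, j) : MvPolynomial (Fin n × Fin n) ℂ))
          (fun b : Fin c => ∑ j : Fin n, (X (j, ψ b) : MvPolynomial (Fin n × Fin n) ℂ))))
        (fun _ : Unit => ∑ i : Fin n, ∑ j : Fin n, (X (i, j) : MvPolynomial (Fin n × Fin n) ℂ))) P) =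
      aeval (Sum.elim (Sum.elim
        (fun ab : Fin r × Fin c => (X ((⇑σ ∘ φ) ab.1, (⇑τ ∘ ψ) ab.2) : MvPolynomial (Fin n × Fin n) ℂ))
        (Sum.elim (fun a : Fin r => ∑ j : Fin n, (X ((⇑σ ∘ φ) a, j) : MvPolynomial (Fin n × Fin n) ℂ))
          (fun b : Fin c => ∑ j : Fin n, (X (j, (⇑τ ∘ ψ) b) : MvPolynomial (Fin n × Fin n) ℂ))))
        (fun _ : Unit => ∑ i : Fin n, ∑ j : Fin n, (X (i, j) : MvPolynomial (Fin n × Fin n) ℂ))) P := by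
  rw [← AlgHom.comp_apply, comp_aeval]
  congr 1
  refine MvPolynomial.algHom_ext fun t => ?_
  rw [aeval_X, aeval_X]
  rcases t with (⟨a, b⟩ | (a | b)) | u
  · simp only [Sum.elim_inl, rename_X, Function.comp_apply]
  · simp only [Sum.elim_inr, Sum.elim_inl, map_sum, rename_X, Function.comp_apply]
    exact Equiv.sum_comp τ (fun j => (X (σ (φ a), j) : MvPolynomial (Fin n × Fin n) ℂ))
  · simp only [Sum.elim_inl, Sum.elim_inr, map_sum, rename_X, Function.comp_apply]
    exact Equiv.sum_comp σ (fun j => (X (j, τ (ψ b)) : MvPolynomial (Fin n × Fin n) ℂ))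
  · simp only [Sum.elim_inr, map_sum, rename_X]
    rw [Equiv.sum_comp σ (fun i => ∑ j : Fin n, (X (i, τ j) : MvPolynomial (Fin n × Fin n) ℂ))]
    exact Finset.sum_congr rfl fun i _ =>
      Equiv.sum_comp τ (fun j => (X (i, j) : MvPolynomial (Fin n × Fin n) ℂ))

/-! ### INJ with `U` -/

/-- **INJ with `U`, row side.** [folklore; cite: DwivediPagoSeppelt2026, §8] -/
theorem sum_injective_placements_aevalU_mem_narrowSpan (n r c : ℕ)
    (P : MvPolynomial (((Fin r × Fin c) ⊕ (Fin r ⊕ Fin c)) ⊕ Unit) ℂ) :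
    (∑ φ ∈ (univ : Finset (Fin r → Fin n)).filter (fun φ => Function.Injective φ), ∑ ψ : Fin c → Fin n,
      aeval (Sum.elim (Sum.elim (fun ab : Fin r × Fin c => (X (φ ab.1, ψ ab.2) : MvPolynomial (Fin n × Fin n) ℂ))
        (Sum.elim (fun a : Fin r => ∑ j : Fin n, (X (φ a, j) : MvPolynomial (Fin n × Fin n) ℂ))
          (fun b : Fin c => ∑ j : Fin n, (X (j, ψ b) : MvPolynomial (Fin n × Fin n) ℂ))))
        (fun _ : Unit => ∑ i : Fin n, ∑ j : Fin n, (X (i, j) : MvPolynomial (Fin n × Fin n) ℂ))) P) ∈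
    Submodule.span ℂ {p : MvPolynomial (Fin n × Fin n) ℂ |
        ∃ (a b : ℕ) (E : Multiset (Fin a × Fin b)),
          treewidth (SimpleGraph.fromRel fun u v : Fin a ⊕ Fin b =>
            ∃ e ∈ E, u = Sum.inl e.1 ∧ v = Sum.inr e.2) ≤ r + c + 1 ∧ p = homPoly E n ℂ} := by
  classical
  refine sum_injective_mem_of_merge _ r n _ fun r' π hπ => ?_
  have hr'le : r' ≤ r := by
    have := Fintype.card_le_of_surjective π hπ
    simpa using this
  simp_rw [aevalU_atoms_comp_rows n r r' c P π]
  refine (Submodule.span_mono ?_)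
    (sum_placements_aevalU_mem_narrowSpan n r' c (rename (Sum.map (Sum.map (Prod.map π id) (Sum.map π id)) id) P))
  rintro p ⟨a, b, E, hE, rfl⟩
  exact ⟨a, b, E, hE.trans (by omega), rfl⟩

/-- **INJ with `U`, both sides.**  For every polynomial `P` in the local atoms and `U` of the core `Fin r × Fin c`, the
sum over injective row AND injective column placements of `P(x_{φa,ψb}, R_{φa}, C_{ψb}, U)` lies in
`span_ℂ {hom_{F,n} : tw F ≤ r + c + 1}`. [folklore; cite: DwivediPagoSeppelt2026, §8] -/
theorem sum_injective_injective_aevalU_mem_narrowSpan (n r c : ℕ)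
    (P : MvPolynomial (((Fin r × Fin c) ⊕ (Fin r ⊕ Fin c)) ⊕ Unit) ℂ) :
    (∑ φ ∈ (univ : Finset (Fin r → Fin n)).filter (fun φ => Function.Injective φ),
      ∑ ψ ∈ (univ : Finset (Fin c → Fin n)).filter (fun ψ => Function.Injective ψ),
      aeval (Sum.elim (Sum.elim (fun ab : Fin r × Fin c => (X (φ ab.1, ψ ab.2) : MvPolynomial (Fin n × Fin n) ℂ))
        (Sum.elim (fun a : Fin r => ∑ j : Fin n, (X (φ a, j) : MvPolynomial (Fin n × Fin n) ℂ))
          (fun b : Fin c => ∑ j : Fin n, (X (j, ψ b) : MvPolynomial (Fin n × Fin n) ℂ))))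
        (fun _ : Unit => ∑ i : Fin n, ∑ j : Fin n, (X (i, j) : MvPolynomial (Fin n × Fin n) ℂ))) P) ∈
    Submodule.span ℂ {p : MvPolynomial (Fin n × Fin n) ℂ |
        ∃ (a b : ℕ) (E : Multiset (Fin a × Fin b)),
          treewidth (SimpleGraph.fromRel fun u v : Fin a ⊕ Fin b =>
            ∃ e ∈ E, u = Sum.inl e.1 ∧ v = Sum.inr e.2) ≤ r + c + 1 ∧ p = homPoly E n ℂ} := by
  classical
  rw [Finset.sum_comm]
  refine sum_injective_mem_of_merge _ c n _ fun c' π hπ => ?_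
  have hc'le : c' ≤ c := by
    have := Fintype.card_le_of_surjective π hπ
    simpa using this
  simp_rw [aevalU_atoms_comp_cols n r c c' P π]
  rw [Finset.sum_comm]
  refine (Submodule.span_mono ?_)
    (sum_injective_placements_aevalU_mem_narrowSpan n r c'
      (rename (Sum.map (Sum.map (Prod.map id π) (Sum.map id π)) id) P))
  rintro p ⟨a, b, E, hE, rfl⟩
  exact ⟨a, b, E, hE.trans (by omega), rfl⟩

end CorePatterns

end Summit.ValiantsHypothesis.ValiantsHypothesis.Theorems

end
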